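import Summits.NavierStokesRegularity.NavierStokesRegularity.Theorems.CoriolisHeadLocalEnergyDriftProbe
import Summits.NavierStokesRegularity.NavierStokesRegularity.Theorems.CoriolisHeadNoCoRotatingCoreUniformDerivatives
import HarnessLib

/-!
# CoriolisHeadLocalEnergyDriftPressure — crux `NoCoRotatingCore` (stmt-NavierStokesRegularity-22676), line `local_energy_rescue`
# (crux workfile, ns-idea-10 g3), stub S1 `stub_driftNormalForm` — file 2/3: the probe of `∂ₑP` at scale `‖x₀‖`

`exists_bound_integral_probeBump_fderiv_pressure`: for a bounded smooth rotated profile (ANY `ν, a > 0`, skew `B`) there is `C`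
with `|∫ χ_R(z) ∂ₑP(x₀ − z) dz| ≤ C‖e‖` whenever `R ≥ max(‖x₀‖, 1)`.  The profile equation gives
`∂ₑP = ⟪e, νΔU − aU − BU − DU[U]⟫ − ⟪e, DU[ay − By]⟫` (`fderiv_pressure_apply_eq`); the first group is bounded pointwise by the
KNSS derivative bounds (tree `exists_norm_iteratedFDeriv_le_of_rotatedProfile`; `exists_bound_inner_nondrift`), the drift group
integrates by parts onto the reflected bump `χ_R(x₀ − ·)` (file 1), where `|ay − By| ≤ 3(|a| + ‖B‖)R` on the support and
`‖Dχ_R‖ ≲ R⁻⁴` on a ball of volume `∼ R³` — bounded precisely because the bump is taken at scale `‖x₀‖`.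

HONEST FRAMING.  Helper for an unregistered line; nothing here proves `NoCoRotatingCore` or NS regularity.

References: G. Koch, N. Nadirashvili, G. Seregin, V. Šverák, Acta Math. 203 (2009), §4 (4.10), §5 [KochNadirashviliSereginSverak2009].
-/

noncomputable section

open MeasureTheory Set Function Filter Topology Metric InnerProductSpace Real
open scoped RealInnerProductSpace Laplacian ContDiff Topology

-- the summit and its single sub-problem share the name (CONVENTIONS §1), as in every Theorems file
set_option linter.dupNamespace false

namespace Summit.NavierStokesRegularity.NavierStokesRegularity.Theorems.CoriolisHead

namespace LocalEnergyRescue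

open Literature.Analysis.FluidPDE

/-! ## §4 The pressure part: `∫ χ_R ∂ₑP(x₀ − ·)` is bounded at scale `R ≥ ‖x₀‖` -/

section Pressure

variable {ν a : ℝ} {B : EuclideanSpace ℝ (Fin 3) →L[ℝ] EuclideanSpace ℝ (Fin 3)}
  {U : EuclideanSpace ℝ (Fin 3) → EuclideanSpace ℝ (Fin 3)} {P : EuclideanSpace ℝ (Fin 3) → ℝ}

/-- Translation of a ball integral: `∫_{B(z,ρ)} h(y + y₀) dy = ∫_{B(z + y₀, ρ)} h`. [folklore] -/
theorem setIntegral_ball_comp_add (h : EuclideanSpace ℝ (Fin 3) → ℝ) (z y₀ : EuclideanSpace ℝ (Fin 3)) (ρ : ℝ) :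
    ∫ y in ball z ρ, h (y + y₀) = ∫ w in ball (z + y₀) ρ, h w := by
  rw [← integral_indicator measurableSet_ball, ← integral_indicator measurableSet_ball]
  have key : ∀ y, (ball z ρ).indicator (fun y => h (y + y₀)) y = (ball (z + y₀) ρ).indicator h (y + y₀) := by
    intro y
    have hmem : y ∈ ball z ρ ↔ y + y₀ ∈ ball (z + y₀) ρ := by
      rw [mem_ball, mem_ball, dist_eq_norm, dist_eq_norm, add_sub_add_right_eq_sub]
    by_cases hy : y ∈ ball z ρ
    · rw [indicator_of_mem hy, indicator_of_mem (hmem.1 hy)]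
    · rw [indicator_of_notMem hy, indicator_of_notMem (fun h' => hy (hmem.2 h'))]
  simp_rw [key]
  exact integral_add_right_eq_self ((ball (z + y₀) ρ).indicator h) y₀

/-- **The profile equation read on `∂ₑP`**: `∂ₑP(y) = ⟪e, νΔU − aU − BU − DU[U]⟫(y) − ⟪e, DU(y)[ay − By]⟫`. [folklore] -/
theorem fderiv_pressure_apply_eq
    (heq : ∀ y, -(ν • (Δ U) y) + a • U y + a • fderiv ℝ U y y + (B (U y) - fderiv ℝ U y (B y)) +
      convect U U y + gradient P y = 0) (y e : EuclideanSpace ℝ (Fin 3)) :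
    fderiv ℝ P y e = ⟪e, ν • (Δ U) y - a • U y - B (U y) - fderiv ℝ U y (U y)⟫ -
      ⟪e, fderiv ℝ U y (a • y - B y)⟫ := by
  rw [← inner_gradient_right_eq_fderiv, gradient_pressure_eq_of_rotated heq y, convect_apply, ← inner_sub_right]
  congr 1
  simp only [map_sub, map_smul]
  abel

/-- **Pointwise bound of the non-drift part of `∂ₑP`** by the KNSS derivative bounds:
`|⟪e, νΔU − aU − BU − DU[U]⟫| ≤ C‖e‖`. [cite: KochNadirashviliSereginSverak2009, §4 (4.10)] -/
theorem exists_bound_inner_nondrift (hν : 0 < ν) (ha : 0 < a)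
    (hU : ContDiff ℝ ∞ U) (hP : ContDiff ℝ 2 P) (hB : ∀ x, inner ℝ (B x) x = 0) (hdiv : VectorCalculus.IsDivFree U)
    (heq : ∀ y, -(ν • (Δ U) y) + a • U y + a • fderiv ℝ U y y + (B (U y) - fderiv ℝ U y (B y)) +
      convect U U y + gradient P y = 0)
    {M : ℝ} (hM : ∀ y, ‖U y‖ ≤ M) :
    ∃ C : ℝ, 0 ≤ C ∧ ∀ y e : EuclideanSpace ℝ (Fin 3),
      |⟪e, ν • (Δ U) y - a • U y - B (U y) - fderiv ℝ U y (U y)⟫| ≤ C * ‖e‖ := by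
  have hM0 : 0 ≤ M := (norm_nonneg _).trans (hM 0)
  have hU2 : ContDiff ℝ 2 U := hU.of_le (by norm_cast)
  have hP1 : ContDiff ℝ 1 P := hP.of_le (by norm_num)
  obtain ⟨D₁, hD₁0, hDU⟩ : ∃ D₁ : ℝ, 0 ≤ D₁ ∧ ∀ y, ‖fderiv ℝ U y‖ ≤ D₁ := by
    obtain ⟨C₁, hC₁0, hC₁⟩ := exists_norm_iteratedFDeriv_le_of_rotatedProfile 1
    refine ⟨C₁ * M ^ (1 + 1) / ν ^ 1, by positivity, fun y => ?_⟩
    rw [← norm_iteratedFDeriv_one (𝕜 := ℝ)]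
    exact hC₁ ν a hν ha B U P hU hP1 hB hdiv heq hM y
  obtain ⟨D₂, hD₂0, hΔU⟩ : ∃ D₂ : ℝ, 0 ≤ D₂ ∧ ∀ y, ‖(Δ U) y‖ ≤ D₂ := by
    obtain ⟨C₂, hC₂0, hC₂⟩ := exists_norm_iteratedFDeriv_le_of_rotatedProfile 2
    refine ⟨3 * (C₂ * M ^ (2 + 1) / ν ^ 2), by positivity, fun y => ?_⟩
    exact (norm_laplacian_le_three_mul_norm_iteratedFDeriv_two hU2 y).trans
      (mul_le_mul_of_nonneg_left (hC₂ ν a hν ha B U P hU hP1 hB hdiv heq hM y) (by norm_num))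
  refine ⟨ν * D₂ + |a| * M + ‖B‖ * M + D₁ * M, by positivity, fun y e => ?_⟩
  have t1 : ‖ν • (Δ U) y‖ ≤ ν * D₂ := by
    rw [norm_smul, Real.norm_of_nonneg hν.le]; exact mul_le_mul_of_nonneg_left (hΔU y) hν.le
  have t2 : ‖a • U y‖ ≤ |a| * M := by
    rw [norm_smul, Real.norm_eq_abs]; exact mul_le_mul_of_nonneg_left (hM y) (abs_nonneg _)
  have t3 : ‖B (U y)‖ ≤ ‖B‖ * M := (B.le_opNorm _).trans (mul_le_mul_of_nonneg_left (hM y) (norm_nonneg _))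
  have t4 : ‖fderiv ℝ U y (U y)‖ ≤ D₁ * M :=
    (ContinuousLinearMap.le_opNorm _ _).trans (mul_le_mul (hDU y) (hM y) (norm_nonneg _) hD₁0)
  have h1 : ‖ν • (Δ U) y - a • U y - B (U y) - fderiv ℝ U y (U y)‖ ≤ ν * D₂ + |a| * M + ‖B‖ * M + D₁ * M := by
    have s1 := norm_sub_le (ν • (Δ U) y - a • U y - B (U y)) (fderiv ℝ U y (U y))
    have s2 := norm_sub_le (ν • (Δ U) y - a • U y) (B (U y))
    have s3 := norm_sub_le (ν • (Δ U) y) (a • U y)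
    linarith
  have h2 := abs_real_inner_le_norm e (ν • (Δ U) y - a • U y - B (U y) - fderiv ℝ U y (U y))
  have h3 := mul_le_mul_of_nonneg_left h1 (norm_nonneg e)
  have h4 : ‖e‖ * (ν * D₂ + |a| * M + ‖B‖ * M + D₁ * M) = (ν * D₂ + |a| * M + ‖B‖ * M + D₁ * M) * ‖e‖ := mul_comm _ _
  linarith [h2, h3, h4.le, h4.ge]

/-- **The pressure part of the probe.**  For a bounded smooth rotated profile there is `C` with
`|∫ χ_R(z) ∂ₑP(x₀ − z) dz| ≤ C‖e‖` whenever `R ≥ max(‖x₀‖, 1)`: by `fderiv_pressure_apply_eq` the non-drift group is bounded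
pointwise (`exists_bound_inner_nondrift`), and the drift group is `abs_integral_mul_fderiv_inner_drift_le` with the reflected
bump `ψ = χ_R(x₀ − ·)`, whose gradient is `O(R⁻⁴)` on a ball of volume `O(R³)` where `|V| ≤ 3(|a| + ‖B‖)R`.
[cite: KochNadirashviliSereginSverak2009, §4 (4.10)] -/
theorem exists_bound_integral_probeBump_fderiv_pressure (hν : 0 < ν) (ha : 0 < a)
    (hU : ContDiff ℝ ∞ U) (hP : ContDiff ℝ 2 P) (hB : ∀ x, inner ℝ (B x) x = 0) (hdiv : VectorCalculus.IsDivFree U)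
    (heq : ∀ y, -(ν • (Δ U) y) + a • U y + a • fderiv ℝ U y y + (B (U y) - fderiv ℝ U y (B y)) +
      convect U U y + gradient P y = 0)
    {M : ℝ} (hM : ∀ y, ‖U y‖ ≤ M) :
    ∃ C : ℝ, 0 ≤ C ∧ ∀ (x₀ e : EuclideanSpace ℝ (Fin 3)) (R : ℝ), 1 ≤ R → ‖x₀‖ ≤ R →
      |∫ z, probeBump R z * fderiv ℝ P (x₀ - z) e| ≤ C * ‖e‖ := by
  have hM0 : 0 ≤ M := (norm_nonneg _).trans (hM 0)
  have hU1 : ContDiff ℝ 1 U := hU.of_le (by norm_cast)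
  have hU2 : ContDiff ℝ 2 U := hU.of_le (by norm_cast)
  obtain ⟨Clin, hClin0, hClin⟩ := exists_bound_inner_nondrift hν ha hU hP hB hdiv heq hM
  -- bump constants
  obtain ⟨Cθ, hCθ⟩ := (exists_bound_baseBump_derivs (E := EuclideanSpace ℝ (Fin 3))).1
  have hCθ0 : 0 ≤ Cθ := (norm_nonneg _).trans (hCθ 0)
  set m₀ : ℝ := baseBumpMass (EuclideanSpace ℝ (Fin 3)) with hm₀
  have hm₀pos : 0 < m₀ := baseBumpMass_pos
  set W₁ : ℝ := (volume (closedBall (0 : EuclideanSpace ℝ (Fin 3)) 1)).toReal with hW₁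
  have hW0 : 0 ≤ W₁ := ENNReal.toReal_nonneg
  refine ⟨Clin + M * (3 * |a|) + M * (24 * (Cθ * m₀⁻¹ * ((|a| + ‖B‖) * W₁))), by positivity,
    fun x₀ e R hR1 hxR => ?_⟩
  have hRpos : 0 < R := by linarith
  -- the derivative of `f = ⟪e, U⟫`
  have hfd : ∀ y v, fderiv ℝ (fun y => ⟪e, U y⟫) y v = ⟪e, fderiv ℝ U y v⟫ := fun y v => by
    rw [fderiv_inner_apply ℝ (differentiableAt_const e) ((hU1.differentiable one_ne_zero) y)]
    simp
  -- continuity of the two pieces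
  have hg₁c : Continuous fun y => ⟪e, ν • (Δ U) y - a • U y - B (U y) - fderiv ℝ U y (U y)⟫ := by
    have h1 : Continuous fun y => fderiv ℝ U y (U y) := (hU1.continuous_fderiv one_ne_zero).clm_apply hU.continuous
    have h2 : Continuous (Δ U) := (contDiff_laplacian (n := 0) hU2).continuous
    exact continuous_const.inner ((((h2.const_smul ν).sub (hU.continuous.const_smul a)).sub
      (B.continuous.comp hU.continuous)).sub h1)
  have hdc : Continuous fun y => ⟪e, fderiv ℝ U y (a • y - B y)⟫ :=
    continuous_const.inner ((hU1.continuous_fderiv one_ne_zero).clm_apply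
      ((continuous_id.const_smul a).sub B.continuous))
  have hχc := hasCompactSupport_probeBump (E := EuclideanSpace ℝ (Fin 3)) hRpos
  have hχcont : Continuous (probeBump (E := EuclideanSpace ℝ (Fin 3)) R) := (contDiff_probeBump R (n := 0)).continuous
  have hsub_c : Continuous fun z : EuclideanSpace ℝ (Fin 3) => x₀ - z := continuous_const.sub continuous_id
  have i1 : Integrable fun z => probeBump R z *
      ⟪e, ν • (Δ U) (x₀ - z) - a • U (x₀ - z) - B (U (x₀ - z)) - fderiv ℝ U (x₀ - z) (U (x₀ - z))⟫ :=
    (hχcont.mul (hg₁c.comp hsub_c)).integrable_of_hasCompactSupport hχc.mul_right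
  have i2 : Integrable fun z => probeBump R z * ⟪e, fderiv ℝ U (x₀ - z) (a • (x₀ - z) - B (x₀ - z))⟫ :=
    (hχcont.mul (hdc.comp hsub_c)).integrable_of_hasCompactSupport hχc.mul_right
  have hsplit : ∫ z, probeBump R z * fderiv ℝ P (x₀ - z) e =
      (∫ z, probeBump R z * ⟪e, ν • (Δ U) (x₀ - z) - a • U (x₀ - z) - B (U (x₀ - z)) -
        fderiv ℝ U (x₀ - z) (U (x₀ - z))⟫) -
      ∫ z, probeBump R z * ⟪e, fderiv ℝ U (x₀ - z) (a • (x₀ - z) - B (x₀ - z))⟫ := by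
    rw [← integral_sub i1 i2]
    refine integral_congr_ae (Eventually.of_forall fun z => ?_)
    show probeBump R z * fderiv ℝ P (x₀ - z) e = _
    rw [fderiv_pressure_apply_eq heq]; ring
  rw [hsplit]
  -- the bounded group
  have hA : |∫ z, probeBump R z * ⟪e, ν • (Δ U) (x₀ - z) - a • U (x₀ - z) - B (U (x₀ - z)) -
      fderiv ℝ U (x₀ - z) (U (x₀ - z))⟫| ≤ Clin * ‖e‖ := by
    have hdom : ∀ z, ‖probeBump R z * ⟪e, ν • (Δ U) (x₀ - z) - a • U (x₀ - z) - B (U (x₀ - z)) -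
        fderiv ℝ U (x₀ - z) (U (x₀ - z))⟫‖ ≤ (Clin * ‖e‖) * probeBump R z := fun z => by
      rw [norm_mul, Real.norm_of_nonneg (probeBump_nonneg hRpos z), Real.norm_eq_abs, mul_comm]
      exact mul_le_mul_of_nonneg_right (hClin (x₀ - z) e) (probeBump_nonneg hRpos z)
    have h := norm_integral_le_of_norm_le ((integrable_probeBump hRpos).const_mul (Clin * ‖e‖))
      (Eventually.of_forall hdom)
    rw [Real.norm_eq_abs, integral_const_mul, integral_probeBump hRpos, mul_one] at h
    exact h
  -- the drift group, through the reflected bump `ψ = χ_R(x₀ − ·)`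
  have hswap := integral_mul_comp_sub_swap (probeBump R) (fun w => ⟪e, fderiv ℝ U w (a • w - B w)⟫) x₀
  rw [hswap]
  have hψ1 : ContDiff ℝ 1 (fun w : EuclideanSpace ℝ (Fin 3) => probeBump R (x₀ - w)) :=
    (contDiff_probeBump R).comp (contDiff_const.sub contDiff_id)
  have hψs : ∀ w, w ∉ closedBall x₀ (2 * R) → probeBump R (x₀ - w) = 0 := fun w hw => by
    refine probeBump_eq_zero hRpos ?_
    rw [mem_closedBall, dist_eq_norm, not_le] at hw
    rw [← norm_neg, neg_sub]; exact hw.le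
  have hψD : ∀ w, ‖fderiv ℝ (fun w : EuclideanSpace ℝ (Fin 3) => probeBump R (x₀ - w)) w‖ ≤
      (m₀ * R ^ 3)⁻¹ * R⁻¹ * Cθ := fun w => by
    rw [fderiv_comp_const_sub, norm_neg]
    have h := norm_fderiv_probeBump_le hRpos hCθ (x₀ - w)
    rwa [finrank_euclideanSpace_fin] at h
  have hψD0 : ∀ w, w ∉ closedBall x₀ (2 * R) →
      fderiv ℝ (fun w : EuclideanSpace ℝ (Fin 3) => probeBump R (x₀ - w)) w = 0 := fun w hw => by
    rw [fderiv_comp_const_sub]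
    have hlt : 2 * R < ‖x₀ - w‖ := by
      rw [mem_closedBall, dist_eq_norm, not_le] at hw
      rwa [← norm_neg, neg_sub]
    have hz' : x₀ - w ∉ tsupport (probeBump (E := EuclideanSpace ℝ (Fin 3)) R) := fun h => by
      have h2 := tsupport_probeBump_subset hRpos h
      rw [mem_closedBall, dist_zero_right] at h2
      linarith
    rw [fderiv_of_notMem_tsupport ℝ hz', neg_zero]
  have hψi : Integrable fun w : EuclideanSpace ℝ (Fin 3) => probeBump R (x₀ - w) :=
    (integrable_probeBump hRpos).comp_sub_left x₀
  have hψ0 : ∀ w, 0 ≤ probeBump R (x₀ - w) := fun w => probeBump_nonneg hRpos _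
  have hψint : ∫ w, probeBump R (x₀ - w) = 1 := by
    rw [integral_sub_left_eq_self (probeBump (E := EuclideanSpace ℝ (Fin 3)) R) volume x₀, integral_probeBump hRpos]
  have hdrift := abs_integral_mul_fderiv_inner_drift_le (a := a) hU1 hM hB e hψ1 hRpos hψs hψD hψD0 hψi hψ0
  simp_rw [hfd] at hdrift
  rw [hψint, mul_one] at hdrift
  -- the volume and the scale
  have hvol : (volume (closedBall x₀ (2 * R))).toReal = (2 * R) ^ 3 * W₁ := by
    rw [hW₁, Measure.addHaar_closedBall' volume x₀ (by positivity : (0:ℝ) ≤ 2 * R), ENNReal.toReal_mul,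
      ENNReal.toReal_ofReal (by positivity), finrank_euclideanSpace_fin]
  rw [hvol] at hdrift
  have hsecond : M * ‖e‖ * ((m₀ * R ^ 3)⁻¹ * R⁻¹ * Cθ * ((|a| + ‖B‖) * (‖x₀‖ + 2 * R))) * ((2 * R) ^ 3 * W₁) ≤
      M * (24 * (Cθ * m₀⁻¹ * ((|a| + ‖B‖) * W₁))) * ‖e‖ := by
    have e1 : M * ‖e‖ * ((m₀ * R ^ 3)⁻¹ * R⁻¹ * Cθ * ((|a| + ‖B‖) * (‖x₀‖ + 2 * R))) * ((2 * R) ^ 3 * W₁) =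
        M * (8 * (Cθ * m₀⁻¹ * ((|a| + ‖B‖) * W₁))) * ‖e‖ * ((‖x₀‖ + 2 * R) * R⁻¹) := by
      field_simp
      ring
    rw [e1]
    have h2 : (‖x₀‖ + 2 * R) * R⁻¹ ≤ 3 := by
      rw [mul_inv_le_iff₀ hRpos]; linarith
    have hpre : 0 ≤ M * (8 * (Cθ * m₀⁻¹ * ((|a| + ‖B‖) * W₁))) * ‖e‖ := by positivity
    nlinarith [mul_le_mul_of_nonneg_left h2 hpre]
  have habs := abs_sub (∫ z, probeBump R z * ⟪e, ν • (Δ U) (x₀ - z) - a • U (x₀ - z) - B (U (x₀ - z)) -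
      fderiv ℝ U (x₀ - z) (U (x₀ - z))⟫) (∫ w, probeBump R (x₀ - w) * ⟪e, fderiv ℝ U w (a • w - B w)⟫)
  linarith [habs, hA, hdrift, hsecond]

end Pressure


end LocalEnergyRescue

end Summit.NavierStokesRegularity.NavierStokesRegularity.Theorems.CoriolisHead

end
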